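/- Copyright: the b2b-balaban cell (near-miss cell 7), T⁴-continuum fan-out, ROUND-2 swarm `t4-ne7b-formalise-*`
(leaf 08), row NE7b (node U5c COUNT member).  Released under the licence of the surrounding project. -/
import Summits.QuantumFields.BalabanUV.T4Continuum.Support.HistoryWindows
import Summits.QuantumFields.BalabanUV.T4Continuum.Support.HistoryAdmissible

/-!
# Realised histories: the geometric layer under the skeleton `PGen`, and the timing discipline DERIVED
(swarm row S1b «H1b geometric layer», part 2 of 2)

Summits-side support leaf of the T⁴-continuum cell (rung (B)+1 on a FINITE torus only; NOT infinite volume, NOT the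
mass gap, NOT the Clay statement; NOT a proof of the spine estimate NE7b).  Row S1b of the swarm claim table
`t4/b2b-balaban-t4-ne7b-p1/LEAVES-NE7b.md` v2.1 (typer mirror `t4/formal/NE7b/LEAVES.md`: «`structure Realises (h : PGen γ)
…` ⊢ `PGen.Adm K`, pending ⇒ `K < reach`, root-cell distinctness of disjoint regions»).  [folklore] finite combinatorics
in the ℤᵈ INDEX MODEL of b02's [K] modules (`B16SProfile`, `B16StoppingRule`, `B16MergeHorizon`) under row S1's
skeleton `HistoryAdmissible.PGen` (p207789) and over part 1 `HistoryWindows` (p208482).  Nothing printed is asserted: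
B16 = [Balaban1989LargeFieldII] §1 pp. 383–387 is under audit; the clauses below TRANSCRIBE its inductive description
of a pending component's geometry (new region = non-empty face-connected `M R_j`-cube family of class `≥ d′_j` with an
anchor cube, p. 381∕383; no event ⇒ `Z ↦ S(Z)` p. 385 (1.83); renewal of a component READY by (i)∕(ii) with `N = R_j`
p. 384 ∕ p. 386 ll. 1–3; join of pending partners whose current domains «intersect, or touch each other» p. 386, merged
domain inside their union (1.84)) in the units of the owner's ruling R-OWNER-22-2 (one cell ≡ one `M R_j`-cube; scales
indexed by the model scale, per-step ratio `L^{δ}` = `B16SProfile.ratio`).  No `[cite:]`; no `def … : Prop` fact of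
print (c1): `orbit`, `Stops`, `PendingAt`, `Realises` are parametrised predicates∕functions of the MODEL; that
Bałaban's terms are indexed by realised histories is H3, displayed elsewhere, never minted.

WHAT.  §1 `orbit L s t₀ Z l` (the `S`-images of a domain formed at step `t₀`, flow exponents `s`), its shift law, and
`Stops` = `B16StoppingRule.StopAt 100 (R t₀) ⊤` on the orbit («the number K» of p. 384 for the CURRENT domain).  §2
**`Realises L s R : PGen (Pt d × Finset (Pt d)) → Finset (Pt d) → Prop`** — the skeleton's birth tags CARRY the region
payload `(anchor, region)` (ruling R3), the second argument is the component's domain at its last event: birth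
(anchor ∈ region, face-connected, `treeLen ≤ class`); renewal at `h + 1` of a line READY AT `h` FOR THE FIRST TIME (its
orbit `Stops` at `h − t` and not before; new domain = the `S`-image); join at `s` of two lines PENDING at `s` (no stop up
to `s`) whose current images TOUCH (`B16MergeGeometry.Touch`), new domain INSIDE the union ((1.84)).  §3 the MAIN
THEOREM **`exists_stop_lt_reach`**: every realised history stops — its top domain's orbit has the stopping property at
some `k ≥ 1` with `lastStep + k < toGen.reach (dictW R n₁)` — for `L ≥ 4`, merger allowance `n₁ ≥ 13`, sizes `R ≥ 1`,
drop-controlled exponents (induction on the skeleton with `HistoryWindows.stopAt_birth ∕ stopAt_restart ∕ stopAt_join`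
and `birth_lt_dictW ∕ restart_lt_dictW ∕ join_lt_dictW`).  §4 COROLLARIES = the displays of S1 DERIVED: **`lt_reach_of_pendingAt`**
(physically pending at `K` ⇒ `K < toGen.reach (dictW R n₁)` — the socket field `pending`), **`adm_of_realises`**
(`PGen.Adm K`), **`joinInLife_of_realises`** (`PGen.JoinInLife (dictW R n₁)`), `renew_lt_reach` (a renewal happens
strictly inside the booked life — the TRUE half of `RenewAtReach`; the equality half is F-1(c), NOT derivable).  §5 root
anchors: `rootAnchor_mem_rootRegion`, **`rootAnchor_ne_of_disjoint`**.  §6 sanity (decided ∕ one-line): a unit region,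
its readiness and a join.

NOT DONE HERE.  The torus reduction of anchors (`HistoryZones.birthCell`, rows S6∕S7); the zone CONTACT in the «shared
block» form of `ZoneReading.overlap` — this file records print's clause (images TOUCH) and nothing stronger (journal
F-leaf08-1: the blocked footprints of touching S-images need not share a block; a tolerance form is the owner's call).
HONEST.  NE7b NOT proved; spine 0∕9.  HONEST DEPENDENCY (cell): continuum YM on T⁴ ⇐ BetaPertH ∧ nine spine estimates
(0/9 proved); BetaPertH ⇐ (D1) ∧ (D4) ∧ CAP+tail; G-an2-4 gates asym, D1 and NE2/3/4.  This file changes none of it. -/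

open Finset
open Literature.MathematicalPhysics.QuantumFieldTheory.Balaban1983to89
open Literature.MathematicalPhysics.QuantumFieldTheory.Balaban1983to89.B13ScaleTransfer
open Literature.MathematicalPhysics.QuantumFieldTheory.Balaban1983to89.TreeLength
open Literature.MathematicalPhysics.QuantumFieldTheory.Balaban1983to89.B16SProfile
open Literature.MathematicalPhysics.QuantumFieldTheory.Balaban1983to89.B16StoppingRule
open Literature.MathematicalPhysics.QuantumFieldTheory.Balaban1983to89.B16MergeGeometry
open Literature.MathematicalPhysics.QuantumFieldTheory.Balaban1983to89.B16MergeHorizon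
open T4PersistenceDictionary
open Summit.QuantumFields.BalabanUV.T4Continuum.HistoryAdmissible
open Summit.QuantumFields.BalabanUV.T4Continuum.HistoryWindows

namespace Summit.QuantumFields.BalabanUV.T4Continuum.HistoryRealise

noncomputable section

variable {d : ℕ}

/-! ## §1 Orbits of a domain under the flow, and the stopping property of the current domain -/

/-- **THE ORBIT** of a domain `Z` formed at step `t₀`: its `S`-image `l` steps later, along the flow's ratio sequence
read from `t₀` (exponents `s`, `R_n = L^{s n}`; ratio `L^{δ}` per step). [folklore] -/
def orbit (L : ℕ) (s : ℕ → ℕ) (t₀ : ℕ) (Z : Finset (Pt d)) (l : ℕ) : Finset (Pt d) :=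
  Siter (ratio L fun i => s (t₀ + i)) l Z

/-- the orbit starts at the domain [folklore] -/
@[simp] theorem orbit_zero (L : ℕ) (s : ℕ → ℕ) (t₀ : ℕ) (Z : Finset (Pt d)) : orbit L s t₀ Z 0 = Z := rfl

/-- one more step is one `S`-operation [folklore] -/
theorem orbit_succ (L : ℕ) (s : ℕ → ℕ) (t₀ : ℕ) (Z : Finset (Pt d)) (l : ℕ) :
    orbit L s t₀ Z (l + 1) = Sop (ratio L (fun i => s (t₀ + i)) l) (orbit L s t₀ Z l) := rfl

/-- **SHIFT LAW**: the orbit from `t₀` after `a + l` steps is the orbit, from `t₀ + a`, of the image after `a` steps.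
[folklore] -/
theorem orbit_add (L : ℕ) (s : ℕ → ℕ) (t₀ : ℕ) (Z : Finset (Pt d)) (a l : ℕ) :
    orbit L s t₀ Z (a + l) = orbit L s (t₀ + a) (orbit L s t₀ Z a) l := by
  unfold orbit
  rw [Siter_add, ratio_shift_fun]
  congr 2
  funext n
  simp [Nat.add_assoc]

/-- orbits are monotone in the domain [folklore] -/
theorem orbit_mono (L : ℕ) (s : ℕ → ℕ) (t₀ : ℕ) {Z Z' : Finset (Pt d)} (h : Z ⊆ Z') (l : ℕ) :
    orbit L s t₀ Z l ⊆ orbit L s t₀ Z' l :=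
  Siter_subset_Siter _ h l

/-- orbits distribute over unions [folklore] -/
theorem orbit_union (L : ℕ) (s : ℕ → ℕ) (t₀ : ℕ) (X Y : Finset (Pt d)) (l : ℕ) :
    orbit L s t₀ (X ∪ Y) l = orbit L s t₀ X l ∪ orbit L s t₀ Y l :=
  Siter_union _ l X Y

/-- **`Stops L s R t₀ Z k`**: the orbit of the domain `Z` formed at `t₀` has the STOPPING PROPERTY of p. 384 at the
relative index `k` — conditions (i) (`100` cubes per side) and (ii) with memory `N = R t₀`, the steps after `t₀` clean
(no event of the history after its last one). [folklore] -/
def Stops (L : ℕ) (s : ℕ → ℕ) (R : ℕ → ℕ) (t₀ : ℕ) (Z : Finset (Pt d)) (k : ℕ) : Prop :=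
  StopAt 100 (R t₀) (fun _ => True) (orbit L s t₀ Z) k

/-- a stop has a positive index [folklore] -/
theorem Stops.pos {L : ℕ} {s R : ℕ → ℕ} {t₀ : ℕ} {Z : Finset (Pt d)} {k : ℕ} (h : Stops L s R t₀ Z k) : 0 < k := h.1

/-- a stop carries condition (i) at its index [folklore] -/
theorem Stops.condI {L : ℕ} {s R : ℕ → ℕ} {t₀ : ℕ} {Z : Finset (Pt d)} {k : ℕ} (h : Stops L s R t₀ Z k) :
    CondI 100 (orbit L s t₀ Z k) := h.2.1

/-- no stop before the memory has elapsed [folklore] -/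
theorem Stops.le {L : ℕ} {s R : ℕ → ℕ} {t₀ : ℕ} {Z : Finset (Pt d)} {k : ℕ} (h : Stops L s R t₀ Z k) : R t₀ ≤ k :=
  le_of_stopAt h

/-- condition (i) passes to sub-domains [folklore] -/
theorem condI_subset {X X' : Finset (Pt d)} (h : X' ⊆ X) (hX : CondI 100 X) : CondI 100 X' := by
  obtain ⟨lo, hlo⟩ := hX
  exact ⟨lo, fun y hy => hlo (Finset.mem_coe.2 (h (Finset.mem_coe.1 hy)))⟩

/-- the stopping property passes to sub-domains (their orbits are smaller) [folklore] -/
theorem Stops.subset {L : ℕ} {s R : ℕ → ℕ} {t₀ : ℕ} {Z Z' : Finset (Pt d)} (hZ : Z' ⊆ Z) {k : ℕ}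
    (h : Stops L s R t₀ Z k) : Stops L s R t₀ Z' k := by
  obtain ⟨hk, hI, hN, hall⟩ := h
  exact ⟨hk, condI_subset (orbit_mono L s t₀ hZ k) hI, hN,
    fun l h1 h2 => ⟨trivial, condI_subset (orbit_mono L s t₀ hZ l) (hall l h1 h2).2⟩⟩

/-- **`PendingAt L s R t₀ Z K`**: the domain formed at `t₀` is still pending at the cutoff `K ≥ t₀` — its orbit has not
stopped at any index up to `K − t₀`. [folklore] -/
def PendingAt (L : ℕ) (s : ℕ → ℕ) (R : ℕ → ℕ) (t₀ : ℕ) (Z : Finset (Pt d)) (K : ℕ) : Prop :=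
  t₀ ≤ K ∧ ∀ k, k ≤ K - t₀ → ¬ Stops L s R t₀ Z k

/-- the drop control on every horizon restricts to the flow read from `t₀` [folklore] -/
theorem dropCtl_from {s : ℕ → ℕ} (hdrop : ∀ m, DropCtl s m) (t₀ m : ℕ) : DropCtl (fun i => s (t₀ + i)) m := by
  have h := B16MergeHorizon.dropCtl_shift (hdrop (t₀ + m)) t₀
  rwa [Nat.add_sub_cancel_left] at h

/-! ## §2 Realised histories -/

/-- **REALISED HISTORIES.**  The skeleton's birth tags carry `(anchor, region)`; `Realises L s R P Z` says that `Z` is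
the domain of the pending component with history `P` at its last event, built by print's three cases: a NEW REGION
(anchor ∈ region, face-connected family of `M R_j`-cubes, class `≥ treeLen`); a RENEWAL at `h + 1` of a line whose
domain is ready AT `h` for the first time (`Stops` at `h − t`, not earlier; the new domain is the `S`-image at `h + 1`);
a JOIN at `s` of two lines both pending at `s` whose current images touch, the joined domain lying inside their union.
[folklore] -/
def Realises (L : ℕ) (s : ℕ → ℕ) (R : ℕ → ℕ) : PGen (Pt d × Finset (Pt d)) → Finset (Pt d) → Prop
  | .birth _ cls zZ, Z => zZ.2 = Z ∧ zZ.1 ∈ Z ∧ FaceConnected Z ∧ treeLen Z ≤ cls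
  | .renew G h, Z => ∃ ZG, Realises L s R G ZG ∧ Stops L s R G.lastStep ZG (h - G.lastStep) ∧
      (∀ k, k < h - G.lastStep → ¬ Stops L s R G.lastStep ZG k) ∧ Z = orbit L s G.lastStep ZG (h + 1 - G.lastStep)
  | .join X Y sj, Z => ∃ ZX ZY, Realises L s R X ZX ∧ Realises L s R Y ZY ∧ X.lastStep ≤ sj ∧ Y.lastStep ≤ sj ∧
      PendingAt L s R X.lastStep ZX sj ∧ PendingAt L s R Y.lastStep ZY sj ∧
      (∃ a ∈ orbit L s X.lastStep ZX (sj - X.lastStep), ∃ c ∈ orbit L s Y.lastStep ZY (sj - Y.lastStep), Touch a c) ∧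
      Z ⊆ orbit L s X.lastStep ZX (sj - X.lastStep) ∪ orbit L s Y.lastStep ZY (sj - Y.lastStep)

/-! ## §3 Every realised history stops, strictly inside its booked life -/

section Main

variable {L : ℕ} {s R : ℕ → ℕ} (hL : 4 ≤ L) (hdrop : ∀ m, DropCtl s m) (hR : ∀ t, 1 ≤ R t) {n₁ : ℕ} (hn₁ : 13 ≤ n₁)
include hL hdrop hR hn₁

/-- **MAIN THEOREM.**  Every realised history STOPS: the orbit of its last domain has the stopping property at some
`k ≥ 1` with `lastStep + k < toGen.reach (dictW R n₁)` — the physical readiness step is strictly inside the BOOKED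
life of the canonical label (`L ≥ 4`, drop control on every horizon, sizes `R ≥ 1`, merger allowance `n₁ ≥ 13`).
Birth: `HistoryWindows.stopAt_birth` + `birth_lt_dictW`; renewal: `stopAt_restart` + `restart_lt_dictW` (NO use of
`RenewAtReach`); join: the induction hypotheses for the partners + `stopAt_join` + `join_lt_dictW`. [folklore] -/
theorem exists_stop_lt_reach :
    ∀ (P : PGen (Pt d × Finset (Pt d))) (Z : Finset (Pt d)), Realises L s R P Z →
      ∃ k, 1 ≤ k ∧ Stops L s R P.lastStep Z k ∧ P.lastStep + k < P.toGen.reach (dictW R n₁)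
  | .birth j cls zZ, Z, hRZ => by
      obtain ⟨-, hz, hZc, hcls⟩ := hRZ
      obtain ⟨i₀, hi₀, hstop, -⟩ := stopAt_birth (Nsz := 100) (by norm_num) (hR j) hL
        (dropCtl_from hdrop j (fatWait cls + R j)) ⟨_, hz⟩ hZc hcls (fun _ => True) (fun _ _ _ => trivial) le_rfl
      refine ⟨i₀ + R j, by have := hR j; omega, hstop, ?_⟩
      have h := birth_lt_dictW R n₁ j hi₀
      simp only [PGen.lastStep, PGen.toGen, Gen.reach_born]
      omega
  | .renew G h, Z, hRZ => by
      obtain ⟨ZG, -, hready, -, rfl⟩ := hRZ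
      have ht : G.lastStep < h := by have := hready.pos; omega
      set t := G.lastStep with ht_def
      -- restart from the readiness scale `h − t` of the old line, memory `R (h+1)`
      have hrs := stopAt_restart (show 3 ≤ L by omega) (dropCtl_from hdrop t (h - t + 1 + R (h + 1)))
        (X := orbit L s t ZG) (fun l => orbit_succ L s t ZG l) hready.condI (hR (h + 1)) (fun _ => True)
        (fun _ _ _ => trivial) le_rfl
      refine ⟨R (h + 1), hR (h + 1), ?_, ?_⟩
      · -- the orbit of the renewed domain from `h + 1` is the old orbit shifted by `h + 1 − t`
        show StopAt 100 (R (h + 1)) (fun _ => True) (orbit L s (h + 1) (orbit L s t ZG (h + 1 - t))) (R (h + 1))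
        obtain ⟨-, hI, -, hall⟩ := hrs
        have hsh : ∀ l, orbit L s (h + 1) (orbit L s t ZG (h + 1 - t)) l = orbit L s t ZG (h - t + 1 + l) := by
          intro l
          rw [show h - t + 1 + l = (h + 1 - t) + l by omega, orbit_add, show t + (h + 1 - t) = h + 1 by omega]
        refine ⟨hR (h + 1), ?_, le_rfl, fun l h1 h2 => ⟨trivial, ?_⟩⟩
        · rw [hsh]; exact hI
        · rw [hsh]; exact (hall (h - t + 1 + l) (by omega) (by omega)).2
      · have h1 := restart_lt_dictW R n₁ (h + 1)
        simp only [PGen.lastStep, PGen.toGen, Gen.reach_renew]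
        omega
  | .join X Y sj, Z, hRZ => by
      obtain ⟨ZX, ZY, hX, hY, htX, htY, hpX, hpY, ⟨a, ha, c, hc, hac⟩, hZ⟩ := hRZ
      obtain ⟨kX, hkX1, hsX, hrX⟩ := exists_stop_lt_reach X ZX hX
      obtain ⟨kY, hkY1, hsY, hrY⟩ := exists_stop_lt_reach Y ZY hY
      set tX := X.lastStep
      set tY := Y.lastStep
      -- partners pending at the join: their stops lie after `sj`
      have hKX : sj - tX < kX := by
        by_contra hle; exact hpX.2 kX (by omega) hsX
      have hKY : sj - tY < kY := by
        by_contra hle; exact hpY.2 kY (by omega) hsY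
      -- condition (i) of the partners at own indices `K₁ = tX + kX − sj`, `K₂ = tY + kY − sj` from the join scale
      have hXI : CondI 100 (Siter (ratio L fun i => s (sj + i)) (tX + kX - sj) (orbit L s tX ZX (sj - tX))) := by
        have h := hsX.condI
        rw [show kX = (sj - tX) + (tX + kX - sj) by omega, orbit_add, show tX + (sj - tX) = sj by omega] at h
        exact h
      have hYI : CondI 100 (Siter (ratio L fun i => s (sj + i)) (tY + kY - sj) (orbit L s tY ZY (sj - tY))) := by
        have h := hsY.condI
        rw [show kY = (sj - tY) + (tY + kY - sj) by omega, orbit_add, show tY + (sj - tY) = sj by omega] at h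
        exact h
      obtain ⟨k, hk1, hkle, hstop⟩ := stopAt_join (show 2 ≤ L by omega)
        (dropCtl_from hdrop sj (max (tX + kX - sj) (tY + kY - sj) + 13 + R sj)) ha hc hac (by omega) (by omega)
        hXI hYI (hR sj) (fun _ => True) (fun _ _ _ => trivial) le_rfl
      refine ⟨k, hk1, ?_, ?_⟩
      · apply Stops.subset hZ
        show StopAt 100 (R sj) (fun _ => True)
          (orbit L s sj (orbit L s tX ZX (sj - tX) ∪ orbit L s tY ZY (sj - tY))) k
        exact hstop
      · have h := join_lt_dictW R hn₁ sj (r₁ := X.toGen.reach (dictW R n₁)) (r₂ := Y.toGen.reach (dictW R n₁)) hkle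
          (by omega) (by omega)
        simp only [PGen.lastStep, PGen.toGen, Gen.reach_merge]
        exact h

/-! ## §4 The displays of row S1, derived -/

/-- **PHYSICALLY PENDING ⇒ INSIDE THE BOOKED LIFE** (the socket field `pending`): if the last domain of a realised
history is still pending at the cutoff `K`, then `K < toGen.reach (dictW R n₁)`. [folklore] -/
theorem lt_reach_of_pendingAt {P : PGen (Pt d × Finset (Pt d))} {Z : Finset (Pt d)} (hP : Realises L s R P Z) {K : ℕ}
    (hK : PendingAt L s R P.lastStep Z K) : K < P.toGen.reach (dictW R n₁) := by
  obtain ⟨k, -, hs, hlt⟩ := exists_stop_lt_reach hL hdrop hR hn₁ P Z hP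
  have : K - P.lastStep < k := by
    by_contra hle; exact hK.2 k (by omega) hs
  omega

/-- **A RENEWAL HAPPENS STRICTLY INSIDE THE BOOKED LIFE of the renewed line**: `h + 1 ≤ G.toGen.reach (dictW R n₁)` —
the true half of `RenewAtReach` (the equality is the landed `Consistent`'s convention, finding F-1(c), not a fact of
the geometry). [folklore] -/
theorem renew_lt_reach {G : PGen (Pt d × Finset (Pt d))} {h : ℕ} {Z : Finset (Pt d)}
    (hP : Realises L s R (.renew G h) Z) : h < G.toGen.reach (dictW R n₁) := by
  obtain ⟨ZG, hG, hready, hfirst, -⟩ := hP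
  obtain ⟨k, -, hs, hlt⟩ := exists_stop_lt_reach hL hdrop hR hn₁ G ZG hG
  have : h - G.lastStep ≤ k := by
    by_contra hlt'; exact hfirst k (by omega) hs
  have := hready.pos
  omega

/-- **`JoinInLife` DERIVED**: every join of a realised history happens inside both partners' BOOKED lives. [folklore] -/
theorem joinInLife_of_realises :
    ∀ (P : PGen (Pt d × Finset (Pt d))) (Z : Finset (Pt d)), Realises L s R P Z → P.JoinInLife (dictW R n₁)
  | .birth _ _ _, _, _ => trivial
  | .renew G h, Z, hP => by
      obtain ⟨ZG, hG, -, -, -⟩ := hP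
      exact joinInLife_of_realises G ZG hG
  | .join X Y sj, Z, hP => by
      obtain ⟨ZX, ZY, hX, hY, -, -, hpX, hpY, -, -⟩ := hP
      exact ⟨joinInLife_of_realises X ZX hX, joinInLife_of_realises Y ZY hY,
        lt_reach_of_pendingAt hL hdrop hR hn₁ hX hpX, lt_reach_of_pendingAt hL hdrop hR hn₁ hY hpY⟩

end Main

/-- **`Adm` DERIVED**: a realised history observed by a cutoff `K ≥ lastStep` obeys print's timing discipline
(renewals after readiness, which is after the last event; joins after both partners' last events). [folklore] -/
theorem adm_of_realises {L : ℕ} {s R : ℕ → ℕ} :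
    ∀ (P : PGen (Pt d × Finset (Pt d))) (Z : Finset (Pt d)), Realises L s R P Z → ∀ {K : ℕ}, P.lastStep ≤ K → P.Adm K
  | .birth _ _ _, _, _, _, hK => hK
  | .renew G h, Z, hP, K, hK => by
      obtain ⟨ZG, hG, hready, -, -⟩ := hP
      have := hready.pos
      simp only [PGen.lastStep] at hK
      exact ⟨adm_of_realises G ZG hG (by omega), by omega, hK⟩
  | .join X Y sj, Z, hP, K, hK => by
      obtain ⟨ZX, ZY, hX, hY, htX, htY, -, -, -, -⟩ := hP
      exact ⟨adm_of_realises X ZX hX (htX.trans hK), adm_of_realises Y ZY hY (htY.trans hK), htX, htY, hK⟩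

/-! ## §5 Root anchors -/

/-- the ROOT REGION: the region payload of the first-born constituent (`PGen.rootCell`'s second component) [folklore] -/
def rootRegion (P : PGen (Pt d × Finset (Pt d))) : Finset (Pt d) := P.rootCell.2

/-- the ROOT ANCHOR: the anchor cube of the first-born constituent [folklore] -/
def rootAnchor (P : PGen (Pt d × Finset (Pt d))) : Pt d := P.rootCell.1

/-- in a realised history the root anchor lies in the root region [folklore] -/
theorem rootAnchor_mem_rootRegion {L : ℕ} {s R : ℕ → ℕ} :
    ∀ (P : PGen (Pt d × Finset (Pt d))) (Z : Finset (Pt d)), Realises L s R P Z → rootAnchor P ∈ rootRegion P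
  | .birth _ _ zZ, Z, hP => by
      obtain ⟨hZ, hz, -, -⟩ := hP
      simpa [rootAnchor, rootRegion, PGen.rootCell, hZ] using hz
  | .renew G h, Z, hP => by
      obtain ⟨ZG, hG, -, -, -⟩ := hP
      exact rootAnchor_mem_rootRegion G ZG hG
  | .join X Y sj, Z, hP => by
      obtain ⟨ZX, ZY, hX, hY, -, -, -, -, -, -⟩ := hP
      unfold rootAnchor rootRegion
      simp only [PGen.rootCell]
      split_ifs
      · exact rootAnchor_mem_rootRegion X ZX hX
      · exact rootAnchor_mem_rootRegion Y ZY hY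

/-- **ROOT-CELL DISTINCTNESS OF DISJOINT REGIONS**: two realised histories whose root regions are disjoint have distinct
root anchors (within one term, distinct pending components have disjoint constituents — the within-term slot
injectivity of the sockets reads off this). [folklore] -/
theorem rootAnchor_ne_of_disjoint {L : ℕ} {s R : ℕ → ℕ} {P P' : PGen (Pt d × Finset (Pt d))} {Z Z' : Finset (Pt d)}
    (hP : Realises L s R P Z) (hP' : Realises L s R P' Z') (hdis : Disjoint (rootRegion P) (rootRegion P')) :
    rootAnchor P ≠ rootAnchor P' := fun h =>
  Finset.disjoint_left.1 hdis (rootAnchor_mem_rootRegion P Z hP) (h ▸ rootAnchor_mem_rootRegion P' Z' hP')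

/-! ## §6 Sanity -/

namespace Sanity

open B16MergeGeometry.OneDim

/-- a unit region at the origin of `ℤ¹`, class `0`, anchored at itself, born at step `0` [folklore] -/
def unit : PGen (Pt 1 × Finset (Pt 1)) := .birth 0 0 (pt 0, {pt 0})

/-- it is realised by its own region [folklore] -/
theorem realises_unit (L : ℕ) (s R : ℕ → ℕ) : Realises L s R unit {pt 0} :=
  ⟨rfl, mem_singleton_self _,
    fun x hx y hy => by rw [mem_singleton] at hx hy; subst hx; subst hy; exact Relation.ReflTransGen.refl,
    by rw [treeLen_singleton]; norm_num⟩

/-- hence (constant flow `s ≡ 0`, sizes `R ≡ 2`, allowance `13`): it stops strictly inside its booked life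
`fatWait 0 + 2 + 1 = 4` [folklore] -/
example : ∃ k, 1 ≤ k ∧ Stops 4 (fun _ => 0) (fun _ => 2) 0 ({pt 0} : Finset (Pt 1)) k ∧ 0 + k < 4 := by
  have h := exists_stop_lt_reach (d := 1) (L := 4) (s := fun _ => 0) (R := fun _ => 2) le_rfl
    (fun m => B16Absorption.dropCtl_const 0 m) (fun _ => by norm_num) (n₁ := 13) le_rfl unit {pt 0}
    (realises_unit 4 _ _)
  simpa [unit, PGen.lastStep, PGen.toGen, dictW, fatWait] using h

end Sanity

end

end Summit.QuantumFields.BalabanUV.T4Continuum.HistoryRealise
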